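import Literature.Barriers.MatrixMultiplication.RectangularBarrier
import Literature.Computability.AlgebraicComplexity.TensorRestrictionRank
import HarnessLib

/-!
# Proof of CLLZ Remark 3.23: `ω + ωα/2 ≤ 3`

Topic `Literature/Barriers/MatrixMultiplication`; discharges the named fact `CLLZ2025_rem323` of
`RectangularBarrier.lean` (`CLLZ2025_rem323_holds`): for every field `K`,
`omega K + omega K * dualExponentAlpha K / 2 ≤ 3`, i.e. `ω ≤ 6/(2+α)`.

Source: M. Christandl, F. Le Gall, V. Lysikov, J. Zuiddam, *Barriers for rectangular matrix
multiplication*, comput. complexity 34 (2025), Remark 3.23 (= Remark 3.22 of arXiv:2003.03019v1,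
the held text): "the matrix multiplication exponent `ω` and the dual exponent `α` are related via
the inequality `ω + (ω/2)α ≤ 3`. Namely, from `⟨⌈n^α⌉, n, n⟩ ≤ ⟨n^{2+o(1)}⟩`,
`⟨n, ⌈n^α⌉, n⟩ ≤ ⟨n^{2+o(1)}⟩` and `⟨n, n, ⌈n^α⌉⟩ ≤ ⟨n^{2+o(1)}⟩` it follows that
`⟨n^{2+α}, n^{2+α}, n^{2+α}⟩ ≤ ⟨n^{6+o(1)}⟩`. Therefore, `ω ≤ 6/(2+α)`, and the claim follows."

## The printed argument, made quantitative (tree conventions of `RectangularExponent.lean`)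

* The product step in rank form,
  `R(⟨n²r, n²r, n²r⟩) ≤ R(⟨n,r,n⟩) · R(⟨r,n,n⟩) · R(⟨n,n,r⟩) = R(⟨n,r,n⟩)³`
  (Bläser 2013 Lemma 5.5/5.8, proof of Thm. 5.9), is the tree lemma
  `Blaser2013_rank_matMulTensor_cube_le` of `TensorRankFactsProofs.lean` (taken with `k = n`,
  `m = r`), used directly below; it is not restated here.
* `omega_mul_le_three_mul_omegaRect` — `(2 + a) · ω ≤ 3 · ω(1,a,1)` for every real `a`: if
  `R(⟨n, ⌈n^a⌉, n⟩) ≤ C n^γ` then, with `N = n²⌈n^a⌉ ≥ n^{2+a}` and `N^ω ≤ R(⟨N,N,N⟩)`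
  (`rpow_omega_le_tensorRank_matMulTensor`, Bläser 2013 Thm. 5.9),
  `n^{(2+a)ω} ≤ N^ω ≤ R(⟨n,⌈n^a⌉,n⟩)³ ≤ C³ n^{3γ}` for all `n ≥ 2`, whence `(2+a)ω ≤ 3γ`
  (`n^{(2+a)ω − 3γ}` would otherwise be unbounded); then `le_csInf` over the admissible `γ`.
  This is the remark's `ω ≤ 6/(2+α)` with `ω(1,a,1) = 2`; no lower bound on the admissible set of
  `ω(1,a,1)` is needed (`le_csInf` only uses non-emptiness, `rectAdmissibleExponents_nonempty`).
* `CLLZ2025_rem323_holds` — `α = sSup {a ∈ [0,1] | ω(1,a,1) = 2}`; every such `a` has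
  `(2+a)ω ≤ 6`, i.e. `a ≤ (6 − 2ω)/ω` (`ω ≥ 2 > 0`, `omega_two_le`), and `(6 − 2ω)/ω ≥ 0`
  (`ω ≤ 3`, `omega_le_three'`), so `Real.sSup_le` (which also covers the empty set, `sSup ∅ = 0`)
  gives `α ≤ (6 − 2ω)/ω`, i.e. `ωα ≤ 6 − 2ω`.

Nothing here is a named fact; the file is sorry-free and uses only proved tree results
(`FlatteningBound.lean`, `KroneckerRank.lean`, `TensorRankFactsProofs.lean`,
`TensorRestrictionRank.lean`, `RectangularExponent.lean`).
-/

noncomputable section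

open Filter Asymptotics

namespace Literature.Barriers.MatrixMultiplication

open Literature.Computability.AlgebraicComplexity

/-- **Rem. 3.23, quantitative core**: for every field `K` and every real `a`,
`(2 + a) · ω ≤ 3 · ω(1, a, 1)` — every admissible exponent `γ` of `⟨n, ⌈n^a⌉, n⟩` gives
`R(⟨N,N,N⟩) ≤ R(⟨n,⌈n^a⌉,n⟩)³ ≤ C³ n^{3γ}` for `N = n²⌈n^a⌉ ≥ n^{2+a}`, while `N^ω ≤ R(⟨N,N,N⟩)`
(Bläser 2013, Thm. 5.9), so `n^{(2+a)ω − 3γ} ≤ C³` for all `n ≥ 2` and hence `(2+a)ω ≤ 3γ`.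
(The remark's "`⟨n^{2+α}, n^{2+α}, n^{2+α}⟩ ≤ ⟨n^{6+o(1)}⟩`, therefore `ω ≤ 6/(2+α)`" is the
case `ω(1,a,1) = 2`.) [cite: ChristandlLeGallLysikovZuiddam2025, Rem. 3.23 (proof)] -/
theorem omega_mul_le_three_mul_omegaRect (K : Type) [Field K] (a : ℝ) :
    (2 + a) * omega K ≤ 3 * omegaRect K 1 a 1 := by
  have key : ∀ γ ∈ rectAdmissibleExponents K 1 a 1, (2 + a) * omega K ≤ 3 * γ := by
    intro γ hγ
    obtain ⟨C, -, hb⟩ := bound_of_isBigO_nat_atTop hγ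
    by_contra hlt
    rw [not_le] at hlt
    -- `n ^ ((2+a)ω − 3γ) → ∞`: pick `n ≥ 2` beyond `C³`
    have hlim : Tendsto (fun n : ℕ => (n : ℝ) ^ ((2 + a) * omega K - 3 * γ)) atTop atTop :=
      (tendsto_rpow_atTop (by linarith)).comp tendsto_natCast_atTop_atTop
    obtain ⟨n, hn, hnC⟩ :=
      ((eventually_ge_atTop 2).and (hlim.eventually_gt_atTop (C ^ 3))).exists
    have hn0 : (0 : ℝ) < n := by exact_mod_cast (by omega : 0 < n)
    have hω0 : 0 ≤ omega K := zero_le_two.trans (omega_two_le K)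
    -- the rectangular bound at `n`: `R(⟨n, ⌈n^a⌉, n⟩) ≤ C n^γ`
    have hRn := hb (Real.rpow_pos_of_pos hn0 γ).ne'
    rw [Real.norm_of_nonneg (Nat.cast_nonneg _), Real.norm_of_nonneg (Real.rpow_nonneg hn0.le _),
      tensorRank_matMulTensor_congr K (rectDim_one n) rfl (rectDim_one n)] at hRn
    -- sizes: `N = n ⌈n^a⌉ n ≥ 2` and `N ≥ n^{2+a}`
    have hr1 : 1 ≤ rectDim n a := one_le_rectDim (by omega) a
    have hN2 : 2 ≤ n * rectDim n a * n :=
      calc 2 = 2 * 1 * 1 := by norm_num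
        _ ≤ n * rectDim n a * n := Nat.mul_le_mul (Nat.mul_le_mul hn hr1) (one_le_two.trans hn)
    have hNge : (n : ℝ) ^ (2 + a) ≤ ((n * rectDim n a * n : ℕ) : ℝ) := by
      have hra : (n : ℝ) ^ a ≤ (rectDim n a : ℝ) := Nat.le_ceil _
      calc (n : ℝ) ^ (2 + a) = (n : ℝ) * (n : ℝ) ^ a * n := by
            rw [Real.rpow_add hn0, Real.rpow_two]; ring
        _ ≤ (n : ℝ) * (rectDim n a : ℝ) * n := by gcongr
        _ = ((n * rectDim n a * n : ℕ) : ℝ) := by norm_cast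
    -- the chain `n^{(2+a)ω} ≤ N^ω ≤ R(⟨N,N,N⟩) ≤ R(⟨n,⌈n^a⌉,n⟩)³ ≤ C³ n^{3γ}`
    have hchain : (n : ℝ) ^ ((2 + a) * omega K) ≤ C ^ 3 * (n : ℝ) ^ (3 * γ) :=
      calc (n : ℝ) ^ ((2 + a) * omega K) = ((n : ℝ) ^ (2 + a)) ^ omega K :=
            Real.rpow_mul hn0.le _ _
        _ ≤ ((n * rectDim n a * n : ℕ) : ℝ) ^ omega K :=
            Real.rpow_le_rpow (Real.rpow_nonneg hn0.le _) hNge hω0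
        _ ≤ (tensorRank (matMulTensor K (n * rectDim n a * n) (n * rectDim n a * n)
              (n * rectDim n a * n)) : ℝ) :=
            rpow_omega_le_tensorRank_matMulTensor K hN2
        _ ≤ ((tensorRank (matMulTensor K n (rectDim n a) n) ^ 3 : ℕ) : ℝ) := by
            exact_mod_cast Blaser2013_rank_matMulTensor_cube_le K n (rectDim n a) n
        _ = (tensorRank (matMulTensor K n (rectDim n a) n) : ℝ) ^ 3 := Nat.cast_pow _ _
        _ ≤ (C * (n : ℝ) ^ γ) ^ 3 := by gcongr
        _ = C ^ 3 * (n : ℝ) ^ (3 * γ) := by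
            rw [mul_pow, ← Real.rpow_natCast ((n : ℝ) ^ γ) 3, ← Real.rpow_mul hn0.le]
            congr 1
            congr 1
            push_cast
            ring
    have hfin : (n : ℝ) ^ ((2 + a) * omega K - 3 * γ) ≤ C ^ 3 := by
      rw [Real.rpow_sub hn0, div_le_iff₀ (Real.rpow_pos_of_pos hn0 _)]
      exact hchain
    exact absurd hfin (not_le.2 hnC)
  have h : (2 + a) * omega K / 3 ≤ omegaRect K 1 a 1 :=
    le_csInf (rectAdmissibleExponents_nonempty K 1 a 1) fun γ hγ => by
      have := key γ hγ
      linarith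
  linarith

/-- **CLLZ Remark 3.23, proved** (discharge of the named fact `CLLZ2025_rem323`): for every field
`K`, `ω + ωα/2 ≤ 3` with the tree's `omega K` and `dualExponentAlpha K`
(`α = sup {a ∈ [0,1] | ω(1,a,1) = 2}`): each such `a` has `(2+a)ω ≤ 6`
(`omega_mul_le_three_mul_omegaRect`), i.e. `a ≤ (6 − 2ω)/ω`, and `(6 − 2ω)/ω ≥ 0` as
`2 ≤ ω ≤ 3`. [cite: ChristandlLeGallLysikovZuiddam2025, Rem. 3.23] -/
theorem CLLZ2025_rem323_holds : CLLZ2025_rem323 := by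
  intro K _
  have hω2 : 2 ≤ omega K := omega_two_le K
  have hω3 : omega K ≤ 3 := omega_le_three' K
  have hωpos : 0 < omega K := by linarith
  have hα : dualExponentAlpha K ≤ (6 - 2 * omega K) / omega K := by
    refine Real.sSup_le (fun a ha => ?_) (div_nonneg (by linarith) hωpos.le)
    have hcore := omega_mul_le_three_mul_omegaRect K a
    rw [ha.2] at hcore
    rw [le_div_iff₀ hωpos]
    linarith
  have h1 : dualExponentAlpha K * omega K ≤ 6 - 2 * omega K := (le_div_iff₀ hωpos).1 hα
  linarith

end Literature.Barriers.MatrixMultiplication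

end
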